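import Summits.QuantumFields.BalabanUV.Beta.FP.TorusReferenceBlock
import Summits.QuantumFields.BalabanUV.Beta.FP.TorusCompositeSliceOneShotG
import Summits.QuantumFields.BalabanUV.Beta.FP.TorusCompositeCovarianceSym

/-!
# `BalabanUV.Beta.FP.TowerDoorGaugeRefDefs` — binder row D1, the row's ONE file, STUB P (P-c), DEFINITIONS (J-NOTE-20 §8, SPEC-64 v3.2 §14 (3)(a)):
# **THE LATTICE GAUGE FUNCTION `λℤ` OF THE DOOR, DEFINED THROUGH THE REFERENCE TORUS `fun _ => Lc`** — the lattice one-shot chart column of a source, read on the ONE-big-block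
# reference box (`refCol`), its nested-slice gauge parameter there (`refSlice`, `refTheta` — road g53 (D)'s formula `θ = −(N·W₀)⁻¹·(N·X)` on the reference tower), and the
# tree-gauge read-out `lamZ` (v10's `hlve` word on the reference tower at the representative `u − L•quo L u` of a lattice site `u`, the source moved by `−quo L u`)
# (β-function cell `pub-balaban`, BINDER-OWNERS row D1 ∕ (C1) OWNER «beta-an2» gen 77, PART 55; over road g54 (C6) `TorusReferenceBlock`)

WHY (located, J-NOTE-20 §6∕§8; road (D) p681260, (C5)∕(C6)).  v10's door reads the tree-gauge function `λ_a = lv n B ((sn·r)•e_a)` of a single top source on every box `B`; the door itself is a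
B-FREE lattice family, so (T2) needs `λ_a` to be the `Mc B`-periodisation of a LATTICE function.  By (D) the gauge parameter is `θ_v = −(N·W₀)⁻¹·(N·X_v)` with `X_v` the one-shot chart column,
`N = fromRows (τ₂·Q₁₀) τ₁` the nested slice, `W₀ = towerGen`; by (C5)∕(C6) the `hlve` word at a finest site `s` depends only on the column read on `s`'s big block, and equals the same word on the
reference torus `fun _ => Lc` (ONE big block `[0, L)^{d+1}`, `L = bigRatio Lc (n+1)`) at the representative `↑s − L•quo L ↑s`.  All three reference operators are FINITE matrices, so the
lattice read-out is DEFINED through them — no lattice comb objects are needed (J-NOTE-20 §6 «lattice twin without new comb Defs»).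

WHAT ([our object — bookkeeping] four `def`s + [folklore] unfoldings and three facts; kernel-generic: any `A : MKer (d+1) (Fib d)`, any level list `lev`, root list `rs` with memberships `hrs`):
* `refCol Lc n A μ z` — the lattice column `b ↦ A ↑b.1 (L•z) (inl b.2) (inr μ)` of the source `(μ, z)` read on the reference box (field rows only);
* `refSlice Lc lev rs hrs n` — the nested slice `fromRows (τ₂·Q₁₀) τ₁` of the reference tower (`τ₂ = combF`, `Q₁₀ = compRowsSym`, `τ₁ = bigP` of the tower below — (D) §2's `N`, primed as in (C6));
* `refTheta Lc lev rs hrs n A μ z := −(refSlice · towerGen)⁻¹ *ᵥ (refSlice *ᵥ refCol)` — (D)'s gauge parameter on the reference tower;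
* `lamZ Lc lev rs hrs n A μ z u := −Σ_{x : Res} [x.1 = ⟨u − L•quo L u, (C6) §1⟩]·(towerEvalC *ᵥ refTheta μ (z − quo L u))(towerEquiv x)` — **THE LATTICE GAUGE FUNCTION**: v10's `hlve` word on the
  reference tower, source and site moved to the block `0` together.
* §2: `refSlice_mul_towerGen_mulVec_refTheta` ((D)'s EQUATION `(N·W₀)·θ = −N·X` holds for `refTheta` once `det (N·W₀) ≠ 0`); **`det_refSlice_mul_towerGen_ne_zero`** — at the record's centred root
  list `fun _ => ctrOff (d+1) Lc` the reference `det (N·W₀) ≠ 0` IS leaf-06 G-2 `torus_hTW_oneShot_towerSym` fed leaf-02's `compRowsSym_mul_towerGen_succ` (no hypothesis left);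
  `lamZ_eq_zero_of_root` (the gauge function vanishes at the big roots — the empty read-out).
WHAT THIS IS NOT: not the periodisation identity `lv (c•e_a) s = c·Σ'_t lamZ … (translate Mc a.1 t) ↑s` (PART 56, over (C6) §2); not the lattice `hΘ`; the door NOT defined; `hlve` NOT instantiated;
nothing of Bałaban's asserted, valued or discharged; 0 estimates; 0∕4 row-D1 binders (hW, hR, D1Tel, D1Rep); v10 NOT filed; v9 p617999 stands; NOT (C1), NOT (T-ID), NOT D1, NEVER «G-an2-4 closed»,
NOT BetaPertH, NOT continuum, NOT Clay.

HONEST DEPENDENCY (page 1, mandatory): continuum YM on T⁴ ⇐ BetaPertH ∧ nine spine estimates (0/9 proved); BetaPertH ⇐ (D1) ∧ (D4) ∧ CAP+tail;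
G-an2-4 gates asym, D1 and NE2/3/4.  HONEST FRAMING (cell contract, verbatim): «discharging `BetaPertH` makes Bałaban's UV stability UNCONDITIONAL —
a real constructive-QFT result; it is NOT the continuum limit and NOT the Clay problem.»  ABSOLUTE RULE (cell charter, verbatim): «No internally-minted
statement may enter as a cited fact. Every hypothesis is either kernel-proved in this package or a verbatim quotation of a PUBLISHED theorem with page
reference. The manuscript(s) under audit are NOT citable for their own disputed steps — they are the thing under adjudication; programme-internal
(2001/route/tribunal) claims are never citable.»  Row D1 ∕ (C1) OWNER «beta-an2» gen 77, 2026-08-29.  No existing file touched.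
-/

noncomputable section

open Finset Matrix
open scoped BigOperators
open Literature.MathematicalPhysics.QuantumFieldTheory
open Literature.MathematicalPhysics.QuantumFieldTheory.Balaban1983to89
open Literature.MathematicalPhysics.QuantumFieldTheory.Balaban1983to89.Beta
open B5Prop11Plancherel (fine)
open B6Lemma24Torus (pbox mem_pbox)
open AffineAveraging (Site box toSite unitVec)
open AveragingContoursRooted (ctrOff ctrOff_mem_box)
open OneStepResolventKernel (Fib)
open ExpKernelCalculus (MKer)
open Literature.MathematicalPhysics.QuantumFieldTheory.LatticeForm (quo)
open Summit.QuantumFields.BalabanUV.Beta.FP.TorusCombForest (rootOf)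
open Summit.QuantumFields.BalabanUV.Beta.FP.TorusCombRows (Res)
open Summit.QuantumFields.BalabanUV.Beta.FP.TorusCompositeObjects
open Summit.QuantumFields.BalabanUV.Beta.FP.TorusCompositeObjectsG (compRowsSym)
open Summit.QuantumFields.BalabanUV.Beta.FP.TorusCompositeUnimodular (towerEvalC)
open Summit.QuantumFields.BalabanUV.Beta.GAN24.FineReadoutCauchyFrame (toSite_mem_range)
open Summit.QuantumFields.BalabanUV.Beta.FP.TorusCompositeSliceOneShotG (torus_hTW_oneShot_towerSym)
open Summit.QuantumFields.BalabanUV.Beta.FP.TorusCompositeCovarianceSym (compRowsSym_mul_towerGen_succ)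
open Summit.QuantumFields.BalabanUV.Beta.FP.TorusReferenceBlock (sub_zsmul_quo_mem_pbox_ref)

namespace Summit.QuantumFields.BalabanUV.Beta.FP.TowerDoorGaugeRefDefs

variable {d : ℕ}

/-! ## §1 The four definitions -/

section Col

variable (Lc : ℕ) (n : ℕ) (A : MKer (d + 1) (Fib d))

/-- [our object — bookkeeping] **THE LATTICE ONE-SHOT COLUMN OF THE SOURCE `(μ, z)`, READ ON THE REFERENCE BOX** (field rows): `refCol b = A ↑b.1 (L•z) (inl b.2) (inr μ)`,
`L = bigRatio Lc (n+1)` — the chart's field–multiplier entry between the finest bond `b` of the one-block reference torus `towerTorus Lc (fun _ => Lc) (n+1)` (as a lattice bond of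
the block `0`) and the multiplier leg `μ` at the coarse site `z` (as the lattice site `L•z`). -/
def refCol (μ : Fin (d + 1)) (z : Site (d + 1)) : ↥(pbox (towerTorus Lc (fun _ : Fin (d + 1) => Lc) (n + 1))) × Fin (d + 1) → ℝ :=
  fun b => A (b.1 : Site (d + 1)) (((bigRatio Lc (n + 1) : ℕ) : ℤ) • z) (Sum.inl b.2) (Sum.inr μ)

/-- [folklore] `refCol` unfolded (`rfl`). -/
theorem refCol_apply (μ : Fin (d + 1)) (z : Site (d + 1)) (b : ↥(pbox (towerTorus Lc (fun _ : Fin (d + 1) => Lc) (n + 1))) × Fin (d + 1)) :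
    refCol Lc n A μ z b = A (b.1 : Site (d + 1)) (((bigRatio Lc (n + 1) : ℕ) : ℤ) • z) (Sum.inl b.2) (Sum.inr μ) := rfl

end Col

section Defs

variable (Lc : ℕ) [NeZero Lc] (lev : ℕ → ℕ) (rs : ℕ → (Fin (d + 1) → ℕ))
  (hrs : ∀ k i, 0 ≤ toSite (rs k) i ∧ toSite (rs k) i < (Lc : ℤ)) (n : ℕ) (A : MKer (d + 1) (Fib d))

/-- [our object — bookkeeping] **THE NESTED SLICE OF THE REFERENCE TOWER** — (D) §2's `N = fromRows (τ₂·Q₁₀) τ₁` on the reference top torus `fun _ => Lc`: the top comb rows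
`combF` composed with the composite sym averaging `compRowsSym`, stacked over the one-shot big comb `bigP` of the tower below ((C6) §2's primed letters `hτ₂' hQ₁₀' hτ₁' hN'`). -/
def refSlice : Matrix (NParam Lc (fun _ : Fin (d + 1) => Lc) rs (n + 1)) (↥(pbox (towerTorus Lc (fun _ : Fin (d + 1) => Lc) (n + 1))) × Fin (d + 1)) ℝ :=
  Matrix.fromRows (combF Lc (fun _ : Fin (d + 1) => Lc) (rs 0) * compRowsSym Lc (fun _ : Fin (d + 1) => Lc) lev rs (n + 1))
    (bigP Lc (fine Lc (fun _ : Fin (d + 1) => Lc)) (fun k => rs (k + 1)) (fun k => hrs (k + 1)) n)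

/-- [our object — bookkeeping] **THE GAUGE PARAMETER OF THE SOURCE `(μ, z)` ON THE REFERENCE TOWER** — road (D)'s formula `θ = −(N·W₀)⁻¹ *ᵥ (N *ᵥ X)` with `N := refSlice`,
`W₀ := towerGen` of the reference tower, `X := refCol`. -/
def refTheta (μ : Fin (d + 1)) (z : Site (d + 1)) : NParam Lc (fun _ : Fin (d + 1) => Lc) rs (n + 1) → ℝ :=
  -((refSlice Lc lev rs hrs n * towerGen Lc (fun _ : Fin (d + 1) => Lc) rs (n + 1))⁻¹ *ᵥ (refSlice Lc lev rs hrs n *ᵥ refCol Lc n A μ z))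

/-- [our object — bookkeeping] **THE LATTICE GAUGE FUNCTION `λℤ` OF THE SOURCE `(μ, z)` AT THE LATTICE SITE `u`** — v10's `hlve` word
`−Σ_{x : Res} [x.1 = s′]·(towerEvalC *ᵥ θ)(towerEquiv x)` on the REFERENCE tower, at the representative `s′ = u − L•quo L u` of `u` in the reference box ((C6) §1
`sub_zsmul_quo_mem_pbox_ref`) and the gauge parameter `refTheta` of the source moved with it, `z − quo L u` (the chart is `L`-block covariant). -/
def lamZ (μ : Fin (d + 1)) (z : Site (d + 1)) (u : Site (d + 1)) : ℝ :=
  -(∑ x : Res (bigRoot Lc rs (n + 1)) (bigRatio Lc (n + 1)) (towerTorus Lc (fun _ : Fin (d + 1) => Lc) (n + 1)),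
      (if (x.1 : ↥(pbox (towerTorus Lc (fun _ : Fin (d + 1) => Lc) (n + 1))))
          = ⟨u + ((bigRatio Lc (n + 1) : ℕ) : ℤ) • (-quo (bigRatio Lc (n + 1)) u), sub_zsmul_quo_mem_pbox_ref Lc n u⟩
        then (towerEvalC Lc (fun _ : Fin (d + 1) => Lc) rs hrs (n + 1) *ᵥ refTheta Lc lev rs hrs n A μ (z - quo (bigRatio Lc (n + 1)) u))
          (towerEquiv Lc (fun _ : Fin (d + 1) => Lc) rs hrs (n + 1) x) else 0))

/-- [folklore] `refSlice` unfolded (`rfl`) — (C6) §2's `hN'` with `hτ₂' hQ₁₀' hτ₁'` all `rfl`. -/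
theorem refSlice_eq : refSlice Lc lev rs hrs n
    = Matrix.fromRows (combF Lc (fun _ : Fin (d + 1) => Lc) (rs 0) * compRowsSym Lc (fun _ : Fin (d + 1) => Lc) lev rs (n + 1))
        (bigP Lc (fine Lc (fun _ : Fin (d + 1) => Lc)) (fun k => rs (k + 1)) (fun k => hrs (k + 1)) n) := rfl

/-- [folklore] `refTheta` unfolded (`rfl`). -/
theorem refTheta_eq (μ : Fin (d + 1)) (z : Site (d + 1)) : refTheta Lc lev rs hrs n A μ z
    = -((refSlice Lc lev rs hrs n * towerGen Lc (fun _ : Fin (d + 1) => Lc) rs (n + 1))⁻¹ *ᵥ (refSlice Lc lev rs hrs n *ᵥ refCol Lc n A μ z)) := rfl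

/-- [folklore] `lamZ` unfolded (`rfl`). -/
theorem lamZ_eq (μ : Fin (d + 1)) (z u : Site (d + 1)) : lamZ Lc lev rs hrs n A μ z u
    = -(∑ x : Res (bigRoot Lc rs (n + 1)) (bigRatio Lc (n + 1)) (towerTorus Lc (fun _ : Fin (d + 1) => Lc) (n + 1)),
        (if (x.1 : ↥(pbox (towerTorus Lc (fun _ : Fin (d + 1) => Lc) (n + 1))))
            = ⟨u + ((bigRatio Lc (n + 1) : ℕ) : ℤ) • (-quo (bigRatio Lc (n + 1)) u), sub_zsmul_quo_mem_pbox_ref Lc n u⟩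
          then (towerEvalC Lc (fun _ : Fin (d + 1) => Lc) rs hrs (n + 1) *ᵥ refTheta Lc lev rs hrs n A μ (z - quo (bigRatio Lc (n + 1)) u))
            (towerEquiv Lc (fun _ : Fin (d + 1) => Lc) rs hrs (n + 1) x) else 0)) := rfl

end Defs

/-! ## §2 Three facts: (D)'s equation on the reference tower, G-2 there by name, the gauge function at the roots -/

section Facts

variable (Lc : ℕ) [NeZero Lc] (lev : ℕ → ℕ) (rs : ℕ → (Fin (d + 1) → ℕ))
  (hrs : ∀ k i, 0 ≤ toSite (rs k) i ∧ toSite (rs k) i < (Lc : ℤ)) (n : ℕ) (A : MKer (d + 1) (Fib d))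

/-- [folklore] **(D)'s EQUATION ON THE REFERENCE TOWER**: once `det (refSlice · towerGen) ≠ 0`, `(refSlice · towerGen) *ᵥ refTheta = −(refSlice *ᵥ refCol)` ((C6) §2's `hθ'`). -/
theorem refSlice_mul_towerGen_mulVec_refTheta
    (hTW : (refSlice Lc lev rs hrs n * towerGen Lc (fun _ : Fin (d + 1) => Lc) rs (n + 1)).det ≠ 0) (μ : Fin (d + 1)) (z : Site (d + 1)) :
    (refSlice Lc lev rs hrs n * towerGen Lc (fun _ : Fin (d + 1) => Lc) rs (n + 1)) *ᵥ refTheta Lc lev rs hrs n A μ z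
      = -(refSlice Lc lev rs hrs n *ᵥ refCol Lc n A μ z) := by
  rw [refTheta_eq, Matrix.mulVec_neg, Matrix.mulVec_mulVec, Matrix.mul_nonsing_inv _ (isUnit_iff_ne_zero.mpr hTW), Matrix.one_mulVec]

/-- [folklore] **G-2 ON THE REFERENCE TOWER, BY NAME** (the record's centred root list `fun _ => ctrOff (d+1) Lc`): `det (refSlice · towerGen) ≠ 0` — leaf-06 `torus_hTW_oneShot_towerSym` at
`M′ := fun _ => Lc` (`Lc ∣ Lc`), its `hc0` discharged by leaf-02 `compRowsSym_mul_towerGen_succ`; NO hypothesis left. -/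
theorem det_refSlice_mul_towerGen_ne_zero (hc : ctrOff (d + 1) Lc ∈ box (d + 1) Lc) :
    (refSlice Lc lev (fun _ : ℕ => ctrOff (d + 1) Lc) (fun k => toSite_mem_range ((fun _ : ℕ => hc) k)) n
        * towerGen Lc (fun _ : Fin (d + 1) => Lc) (fun _ : ℕ => ctrOff (d + 1) Lc) (n + 1)).det ≠ 0 :=
  torus_hTW_oneShot_towerSym (fun _ : Fin (d + 1) => Lc) Lc lev (fun _ : ℕ => ctrOff (d + 1) Lc) n (fun _ => hc) (fun _ => dvd_rfl)
    (compRowsSym_mul_towerGen_succ Lc hc n (fun _ : Fin (d + 1) => Lc) lev) rfl rfl rfl rfl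

/-- [folklore] **THE GAUGE FUNCTION VANISHES AT THE BIG ROOTS**: if the representative `u − L•quo L u` is a root of the reference big comb, `lamZ … u = 0` (no residual parameter sits there —
the read-out is the empty sum; v10's «`λ = 0` at the block roots»). -/
theorem lamZ_eq_zero_of_root (μ : Fin (d + 1)) (z u : Site (d + 1))
    (hu : u + ((bigRatio Lc (n + 1) : ℕ) : ℤ) • (-quo (bigRatio Lc (n + 1)) u)
      = rootOf (bigRoot Lc rs (n + 1)) (bigRatio Lc (n + 1)) (u + ((bigRatio Lc (n + 1) : ℕ) : ℤ) • (-quo (bigRatio Lc (n + 1)) u))) :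
    lamZ Lc lev rs hrs n A μ z u = 0 := by
  rw [lamZ_eq, neg_eq_zero]
  refine Finset.sum_eq_zero fun x _ => ?_
  rw [if_neg]
  intro hx
  apply x.2
  have e := congrArg (fun s : ↥(pbox (towerTorus Lc (fun _ : Fin (d + 1) => Lc) (n + 1))) => (s : Site (d + 1))) hx
  simp only at e
  show ((x.1 : ↥(pbox (towerTorus Lc (fun _ : Fin (d + 1) => Lc) (n + 1)))) : Site (d + 1)) = _
  rw [e]
  exact hu

end Facts

end Summit.QuantumFields.BalabanUV.Beta.FP.TowerDoorGaugeRefDefs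

end
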